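import Literature.AlgebraicGeometry.HodgeTheory.AbelianVarietyCotangentDifferential
import Literature.AlgebraicGeometry.Motives.DualNumberPoints
import HarnessLib

/-!
# The tangent space of a complex abelian variety as `ℂ[ε]`-points, identified with `V` along an analytification

Layer `Literature/AlgebraicGeometry/HodgeTheory`, namespace `Literature.AlgebraicGeometry.Motives.AbelianVariety`.
THEOREMS ONLY (no definition, no named fact, no instance).  [GortzWedhorn2020] (6.3)–(6.4): the tangent space at a
rational point = `k[ε]`-points through it = derivations `𝒪_{X,x} → k` = `(𝔪_x/𝔪_x²)^∨`; [LangeBirkenhake1992] §1.1.5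
/ [MumfordAV1970] §1 (1)–(2), §13: for a complex abelian variety `B` analytified by `φ : M → B(ℂ)` (model `ℂ^{dim B}`),
`T_x B ≅ ℂ^{dim B}` through the differential of regular functions along `φ`.  Sequel of ★
`HodgeTheory/AbelianVarietyCotangentDifferential` (the differential `Ψ₀ : 𝔪_e/𝔪_e² ≅ E^*` at the ORIGIN), here at ANY
point `x = (φ P).pt`, and of ★ `Motives/DualNumberPoints` (the local homomorphism `dualNumberStalkHom w : 𝒪_{B,x₀} → ℂ[ε]`
of a `ℂ[ε]`-point `w` and its `ε`-part):

* `exists_sub_scalar_mem_maximalIdeal` (`𝒪_x = ℂ + 𝔪_x`), `algebraMap_residueField_bijective_at` (`κ(x) = ℂ`),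
  `ringKrullDim_stalk_of_isClosed` (`dim 𝒪_x = dim B` at closed points; ★ `ringKrullDim_stalkOrigin` verbatim at `x`),
  `finrank_residueField_cotangentSpace_of_isClosed`, `isScalarTower_residueField_cotangentSpace`,
  **`finrank_cotangentSpace_at`** (`dim_ℂ 𝔪_x/𝔪_x² = dim B`), `finrank_dual_clm`;
* **`exists_cotangentDifferential_at`** — the differential `Ψ : 𝔪_x/𝔪_x² ≃ₗ[ℂ] E^*`, `Ψ(d s) = D(s ∘ φ ∘ χ_P⁻¹)(χ_P P)`;
  `mem_sq_of_stalkDifferential_eq_zero_at` (its injectivity read on stalk elements); `exists_eval_eq_of_functional`;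
* **`existsUnique_tangentVector_of_dualNumber_at`** — for a `ℂ[ε]`-point `w` of `B` through `x₀ = (φ P).pt` there is a
  UNIQUE `v ∈ ℂ^{dim B}` with `(dualNumberStalkHom w (germ s)).snd = ∂_v (s ∘ φ ∘ χ_P⁻¹)(χ_P P)` for all regular `s` near
  `x₀`; `exists_eq_toUnit_comp_of_tangentVector_eq_zero_at` (`v = 0` ⇒ `w` constant).

Mathlib searched (pin): `Ideal.Cotangent.lift`, `Ideal.toCotangent_eq_zero`, `IsRegularLocalRing.iff_finrank_cotangentSpace`,
`IsLocalization.AtPrime.ringKrullDim_eq_height`, `Subspace.dual_finrank_eq`, `LinearMap.toContinuousLinearMap`,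
`LinearMap.pi_apply_eq_sum_univ`, `Module.Basis.constr`, `LinearMap.injective_iff_surjective_of_finrank_eq_finrank`
(used).  The `ℂ`-algebra structure on `𝒪_{B,x}` is installed locally through
`letI := ((germ ⊤ x).hom.comp (B.X.hom.appTop.hom.comp (ΓSpecIso ℂ).inv.hom)).toAlgebra` (the formula of ★
`stalkOriginAlgebraMap`, at `x`).

## References

* U. Görtz, T. Wedhorn, *Algebraic Geometry I* (2nd ed. 2020): (6.3)–(6.4), Def. 6.2, Lemma 6.26 (p. 161), Prop. 3.8.
  [GortzWedhorn2020]
* U. Görtz, T. Wedhorn, *Algebraic Geometry II* (2023): Prop. 27.20 (p. 611). [GortzWedhorn2023]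
* H. Lange, Ch. Birkenhake, *Complex Abelian Varieties* (1992): §1.1.5 (before Lemma 1.1.22). [LangeBirkenhake1992]
* J.-P. Serre, *Géométrie algébrique et géométrie analytique* (1956): §2 n°6 Prop. 3 Cor. 2. [SerreGAGA1956]
* D. Mumford, *Abelian Varieties* (1970): §1 (1)–(2); §13, proof of the Theorem pp. 125–130. [MumfordAV1970]
-/

set_option autoImplicit false

noncomputable section

universe u

open CategoryTheory CategoryTheory.Limits AlgebraicGeometry Topology Filter TopologicalSpace MonoidalCategory
open scoped Manifold ContDiff DualNumber
open Literature.AlgebraicGeometry.Motives (AlgPoints ComplexPoints SchemeOver AbelianVariety)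
open Literature.AlgebraicGeometry.Motives.AlgPoints
open Literature.NumberTheory.Transcendental Literature.NumberTheory.Transcendental.IsAnalytification
open Literature.AlgebraicGeometry.HodgeTheory

namespace Literature.AlgebraicGeometry.Motives.AbelianVariety

/-! ## The identification of `ℂ[ε]`-points through `x₀ = (φ P).pt` with `V`, along any analytification -/

section AnyPoint

variable {B : AbelianVariety ℂ} {M : Type*} [TopologicalSpace M] [ChartedSpace (Fin B.dim → ℂ) M]
  [IsManifold 𝓘(ℂ, Fin B.dim → ℂ) ω M] {φ : M → ComplexPoints B.X}


/-- **`𝒪_{B,x} = ℂ + 𝔪_x` at a point of the analytification**: every germ differs from a scalar by an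
element of `𝔪_x` (the scalar is its value at the `ℂ`-point). [cite: GortzWedhorn2020, Prop. 3.8] -/
theorem exists_sub_scalar_mem_maximalIdeal (hφ : IsAnalytification (Fin B.dim → ℂ) B.X B.dim φ)
    (P : M) {x : B.X.left} (hx : (φ P).pt = x) (t : B.X.left.presheaf.stalk x) :
    ∃ c : ℂ, t - ((B.X.left.presheaf.germ ⊤ x trivial).hom.comp (B.X.hom.appTop.hom.comp (Scheme.ΓSpecIso (.of ℂ)).inv.hom)) c ∈ IsLocalRing.maximalIdeal _ := by
  obtain ⟨U, hU, s, rfl⟩ := B.X.left.presheaf.exists_germ_eq t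
  obtain ⟨D, hD⟩ := exists_stalkDifferential_of_eq hφ P hx
  obtain ⟨hmem, -⟩ := stalkDifferential_sub_value hφ P hx D hD U hU s
  refine ⟨evalOrZero U s (φ P), ?_⟩
  rwa [map_sub, TopCat.Presheaf.germ_res_apply] at hmem

/-- **`κ(x) = ℂ`** at a point of the analytification, for the `ℂ`-structure `ℂ → Γ(B, 𝒪) → 𝒪_{B,x}`.
[cite: GortzWedhorn2020, Prop. 3.8] -/
theorem algebraMap_residueField_bijective_at (hφ : IsAnalytification (Fin B.dim → ℂ) B.X B.dim φ)
    (P : M) {x : B.X.left} (hx : (φ P).pt = x) :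
    letI := ((B.X.left.presheaf.germ ⊤ x trivial).hom.comp (B.X.hom.appTop.hom.comp (Scheme.ΓSpecIso (.of ℂ)).inv.hom)).toAlgebra
    Function.Bijective (algebraMap ℂ (IsLocalRing.ResidueField (B.X.left.presheaf.stalk x))) := by
  letI := ((B.X.left.presheaf.germ ⊤ x trivial).hom.comp (B.X.hom.appTop.hom.comp (Scheme.ΓSpecIso (.of ℂ)).inv.hom)).toAlgebra
  have heq : ⇑(algebraMap ℂ (IsLocalRing.ResidueField (B.X.left.presheaf.stalk x))) =
      fun c => IsLocalRing.residue _ (((B.X.left.presheaf.germ ⊤ x trivial).hom.comp (B.X.hom.appTop.hom.comp (Scheme.ΓSpecIso (.of ℂ)).inv.hom)) c) := by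
    funext c
    rw [IsScalarTower.algebraMap_apply ℂ (B.X.left.presheaf.stalk x)
      (IsLocalRing.ResidueField (B.X.left.presheaf.stalk x)), IsLocalRing.ResidueField.algebraMap_eq]
    rfl
  rw [heq]
  refine ⟨((IsLocalRing.residue _).comp ((B.X.left.presheaf.germ ⊤ x trivial).hom.comp (B.X.hom.appTop.hom.comp (Scheme.ΓSpecIso (.of ℂ)).inv.hom))).injective, fun r => ?_⟩
  obtain ⟨a, rfl⟩ := IsLocalRing.residue_surjective r
  obtain ⟨c, hc⟩ := exists_sub_scalar_mem_maximalIdeal hφ P hx a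
  refine ⟨c, ?_⟩
  have h : IsLocalRing.residue _ (a - ((B.X.left.presheaf.germ ⊤ x trivial).hom.comp (B.X.hom.appTop.hom.comp (Scheme.ΓSpecIso (.of ℂ)).inv.hom)) c) = 0 :=
    (IsLocalRing.residue_eq_zero_iff _).mpr hc
  rw [map_sub, sub_eq_zero] at h
  exact h.symm

/-- **`dim 𝒪_{B,x} = dim B` at a closed point** (★ `ringKrullDim_stalkOrigin` verbatim at `x`).
[cite: GortzWedhorn2020, Lemma 6.26 (p. 161)] -/
theorem ringKrullDim_stalk_of_isClosed (B : AbelianVariety ℂ) {x : B.X.left}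
    (hx : IsClosed ({x} : Set B.X.left)) : ringKrullDim (B.X.left.presheaf.stalk x) = B.dim := by
  haveI := B.smoothOfRelativeDimension_dim
  obtain ⟨V, hV, hxV, ψ, hψ⟩ :=
    exists_isStandardSmoothOfRelativeDimension_of_field B.X.hom B.dim x
  algebraize [ψ]
  haveI hmax : (hV.primeIdealOf ⟨x, hxV⟩).asIdeal.IsMaximal :=
    hV.primeIdealOf_isMaximal_of_isClosed ⟨x, hxV⟩ hx
  have hloc := hV.isLocalization_stalk ⟨x, hxV⟩
  rw [@IsLocalization.AtPrime.ringKrullDim_eq_height _ _ (hV.primeIdealOf ⟨x, hxV⟩).asIdeal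
    _ (B.X.left.presheaf.stalk x) _ (TopCat.Presheaf.algebra_section_stalk B.X.left.presheaf ⟨x, hxV⟩)
    hloc]
  exact_mod_cast height_eq_of_isStandardSmoothOfRelativeDimension ℂ B.dim _

/-- `dim_{κ(x)} 𝔪_x/𝔪_x² = dim B` at a closed point (regularity ★ `isRegularLocalRing_stalk`).
[cite: GortzWedhorn2020, Lemma 6.26 (p. 161)] [cite: GortzWedhorn2023, Prop. 27.20 (p. 611)] -/
theorem finrank_residueField_cotangentSpace_of_isClosed (B : AbelianVariety ℂ) {x : B.X.left}
    (hx : IsClosed ({x} : Set B.X.left)) :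
    Module.finrank (IsLocalRing.ResidueField (B.X.left.presheaf.stalk x))
      (IsLocalRing.CotangentSpace (B.X.left.presheaf.stalk x)) = B.dim := by
  haveI : IsRegularLocalRing (B.X.left.presheaf.stalk x) := B.isRegularLocalRing_stalk x
  have h := (IsRegularLocalRing.iff_finrank_cotangentSpace (B.X.left.presheaf.stalk x)).1 inferInstance
  rw [ringKrullDim_stalk_of_isClosed B hx] at h
  exact_mod_cast h

/-- The `ℂ`-action on `𝔪_x/𝔪_x²` factors through `κ(x)` (scalar tower), for the scalar structure. [folklore] -/
private theorem isScalarTower_residueField_cotangentSpace (Y : SchemeOver ℂ) (x : Y.left) :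
    letI := ((Y.left.presheaf.germ ⊤ x trivial).hom.comp (Y.hom.appTop.hom.comp (Scheme.ΓSpecIso (.of ℂ)).inv.hom)).toAlgebra
    IsScalarTower ℂ (IsLocalRing.ResidueField (Y.left.presheaf.stalk x))
      (IsLocalRing.CotangentSpace (Y.left.presheaf.stalk x)) := by
  letI := ((Y.left.presheaf.germ ⊤ x trivial).hom.comp (Y.hom.appTop.hom.comp (Scheme.ΓSpecIso (.of ℂ)).inv.hom)).toAlgebra
  refine ⟨fun c r v => ?_⟩
  obtain ⟨r, rfl⟩ := IsLocalRing.residue_surjective r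
  have h2 : ∀ r : Y.left.presheaf.stalk x, (IsLocalRing.residue _ r) • v = r • v :=
    fun r => algebraMap_smul (IsLocalRing.ResidueField (Y.left.presheaf.stalk x)) r v
  have h1 : c • IsLocalRing.residue _ r = IsLocalRing.residue (Y.left.presheaf.stalk x) (c • r) := by
    rw [Algebra.smul_def, Algebra.smul_def, map_mul,
      IsScalarTower.algebraMap_apply ℂ (Y.left.presheaf.stalk x)
        (IsLocalRing.ResidueField (Y.left.presheaf.stalk x))]
    rfl
  rw [h1, h2, h2, smul_assoc]

/-- **`dim_ℂ 𝔪_x/𝔪_x² = dim B`** at a point of the analytification (closed, `κ(x) = ℂ`).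
[cite: GortzWedhorn2023, Prop. 27.20 (p. 611)] -/
theorem finrank_cotangentSpace_at (hφ : IsAnalytification (Fin B.dim → ℂ) B.X B.dim φ)
    (P : M) {x : B.X.left} (hx : (φ P).pt = x) :
    letI := ((B.X.left.presheaf.germ ⊤ x trivial).hom.comp (B.X.hom.appTop.hom.comp (Scheme.ΓSpecIso (.of ℂ)).inv.hom)).toAlgebra
    Module.finrank ℂ (IsLocalRing.CotangentSpace (B.X.left.presheaf.stalk x)) = B.dim := by
  letI := ((B.X.left.presheaf.germ ⊤ x trivial).hom.comp (B.X.hom.appTop.hom.comp (Scheme.ΓSpecIso (.of ℂ)).inv.hom)).toAlgebra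
  let κ := IsLocalRing.ResidueField (B.X.left.presheaf.stalk x)
  have hbij := algebraMap_residueField_bijective_at hφ P hx
  let eκ : ℂ ≃ₗ[ℂ] κ := LinearEquiv.ofBijective (Algebra.linearMap ℂ κ) hbij
  have hk1 : Module.finrank ℂ κ = 1 := by rw [← eκ.finrank_eq, Module.finrank_self]
  haveI := isScalarTower_residueField_cotangentSpace B.X x
  have hclosed : IsClosed ({x} : Set B.X.left) := hx ▸ (φ P).isClosed_pt
  rw [← Module.finrank_mul_finrank ℂ κ (IsLocalRing.CotangentSpace _), hk1,
    finrank_residueField_cotangentSpace_of_isClosed B hclosed, one_mul]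

/-- `dim_ℂ E^* = dim_ℂ E` for continuous linear functionals on `ℂⁿ`. [folklore] -/
private theorem finrank_dual_clm (n : ℕ) :
    Module.finrank ℂ ((Fin n → ℂ) →L[ℂ] ℂ) = n := by
  rw [← (LinearMap.toContinuousLinearMap : ((Fin n → ℂ) →ₗ[ℂ] ℂ) ≃ₗ[ℂ] ((Fin n → ℂ) →L[ℂ] ℂ)).finrank_eq,
    Subspace.dual_finrank_eq, Module.finrank_fin_fun]

/-- **The differential at a point is an isomorphism `𝔪_x/𝔪_x² ≅ E^*`** (★
`exists_cotangentDifferential_of_isAnalytification` verbatim, at ANY point `x = (φ P).pt` instead of the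
origin: the stalk differential restricted to `𝔪_x` kills `𝔪_x²`, is onto by GAGA at a point, and
`dim_ℂ 𝔪_x/𝔪_x² = dim B = dim E`). [cite: LangeBirkenhake1992, §1.1.5 (before Lemma 1.1.22)]
[cite: SerreGAGA1956, §2 n°6 Prop. 3 Cor. 2] -/
theorem exists_cotangentDifferential_at (hφ : IsAnalytification (Fin B.dim → ℂ) B.X B.dim φ)
    (P : M) {x : B.X.left} (hx : (φ P).pt = x) :
    letI := ((B.X.left.presheaf.germ ⊤ x trivial).hom.comp (B.X.hom.appTop.hom.comp (Scheme.ΓSpecIso (.of ℂ)).inv.hom)).toAlgebra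
    ∃ Ψ : IsLocalRing.CotangentSpace (B.X.left.presheaf.stalk x) ≃ₗ[ℂ] ((Fin B.dim → ℂ) →L[ℂ] ℂ),
      ∀ (U : B.X.left.Opens) (hU : x ∈ U) (s : Γ(B.X.left, U))
        (hs : B.X.left.presheaf.germ U x hU s ∈ IsLocalRing.maximalIdeal (B.X.left.presheaf.stalk x)),
        Ψ ((IsLocalRing.maximalIdeal _).toCotangent ⟨_, hs⟩) =
          fderiv ℂ (fun z ↦ evalOrZero U s (φ ((chartAt (Fin B.dim → ℂ) P).symm z)))
            (chartAt (Fin B.dim → ℂ) P P) := by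
  classical
  haveI : SmoothOfRelativeDimension B.dim B.X.hom := B.smoothOfRelativeDimension_dim
  letI alg : Algebra ℂ (B.X.left.presheaf.stalk x) := ((B.X.left.presheaf.germ ⊤ x trivial).hom.comp (B.X.hom.appTop.hom.comp (Scheme.ΓSpecIso (.of ℂ)).inv.hom)).toAlgebra
  obtain ⟨D, hD⟩ := exists_stalkDifferential_of_eq hφ P hx
  -- the differential restricted to `𝔪_x`, `ℂ`-linear
  let f : IsLocalRing.maximalIdeal (B.X.left.presheaf.stalk x) →ₗ[ℂ] ((Fin B.dim → ℂ) →L[ℂ] ℂ) :=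
    { toFun := fun a ↦ D a
      map_add' := fun a b ↦ by rw [Submodule.coe_add, map_add]
      map_smul' := fun c a ↦ by
        rw [RingHom.id_apply, Submodule.coe_smul_of_tower, Algebra.smul_def]
        exact stalkDifferential_const_mul hφ P hx D hD c a }
  have hf : ∀ a b : IsLocalRing.maximalIdeal (B.X.left.presheaf.stalk x), f (a * b) = 0 := fun a b ↦
    stalkDifferential_mul_eq_zero hφ P hx D hD a.2 b.2
  let Ψ : IsLocalRing.CotangentSpace (B.X.left.presheaf.stalk x) →ₗ[ℂ] ((Fin B.dim → ℂ) →L[ℂ] ℂ) :=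
    Ideal.Cotangent.lift f hf
  have hΨ : ∀ (U : B.X.left.Opens) (hU : x ∈ U) (s : Γ(B.X.left, U))
      (hs : B.X.left.presheaf.germ U x hU s ∈ IsLocalRing.maximalIdeal (B.X.left.presheaf.stalk x)),
      Ψ ((IsLocalRing.maximalIdeal _).toCotangent ⟨_, hs⟩) =
        fderiv ℂ (fun z ↦ evalOrZero U s (φ ((chartAt (Fin B.dim → ℂ) P).symm z)))
          (chartAt (Fin B.dim → ℂ) P P) := by
    intro U hU s hs
    exact (Ideal.Cotangent.lift_toCotangent f hf ⟨_, hs⟩).trans (hD U hU s)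
  -- onto: GAGA at a point
  have hsurj : Function.Surjective Ψ := by
    obtain ⟨ℓ, -, hspan, hℓ, -⟩ := exists_rational_cotangentFrame (k := ℂ) hφ (P := P)
      (fun U hU s ↦ ⟨(φ P).eval U hU s, by rw [Algebra.algebraMap_self, RingHom.id_apply]⟩)
    rw [← LinearMap.range_eq_top, eq_top_iff]
    refine hspan.trans (Submodule.span_le.2 ?_)
    rintro _ ⟨i, rfl⟩
    obtain ⟨U, s, hPU, hDs⟩ := hℓ i
    have hU : x ∈ U := hx ▸ hPU
    obtain ⟨hmem, hval⟩ := stalkDifferential_sub_value hφ P hx D hD U hU s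
    have hmem' : B.X.left.presheaf.germ U x hU _ ∈
        IsLocalRing.maximalIdeal (B.X.left.presheaf.stalk x) := hmem
    refine ⟨(IsLocalRing.maximalIdeal _).toCotangent ⟨_, hmem'⟩, ?_⟩
    rw [hΨ U hU _ hmem', ← hD U hU, hval, hDs.fderiv]
  -- dimensions
  have hfin : Module.finrank ℂ (IsLocalRing.CotangentSpace (B.X.left.presheaf.stalk x)) =
      Module.finrank ℂ ((Fin B.dim → ℂ) →L[ℂ] ℂ) := by
    rw [finrank_cotangentSpace_at hφ P hx, finrank_dual_clm]
  haveI : Module.Finite ℂ (IsLocalRing.CotangentSpace (B.X.left.presheaf.stalk x)) := by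
    let κ := IsLocalRing.ResidueField (B.X.left.presheaf.stalk x)
    have hbij := algebraMap_residueField_bijective_at hφ P hx
    let eκ : ℂ ≃ₗ[ℂ] κ := LinearEquiv.ofBijective (Algebra.linearMap ℂ κ) hbij
    haveI : Module.Finite ℂ κ := Module.Finite.equiv eκ
    haveI := isScalarTower_residueField_cotangentSpace B.X x
    exact Module.Finite.trans κ _
  have hinj : Function.Injective Ψ :=
    (LinearMap.injective_iff_surjective_of_finrank_eq_finrank hfin).2 hsurj
  exact ⟨LinearEquiv.ofBijective Ψ ⟨hinj, hsurj⟩, hΨ⟩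

/-- **A stalk element of `𝔪_x` whose analytic differential vanishes lies in `𝔪_x²`** (injectivity of the
differential at the point `x = (φ P).pt`). [cite: LangeBirkenhake1992, §1.1.5 (before Lemma 1.1.22)]
[cite: SerreGAGA1956, §2 n°6 Prop. 3 Cor. 2] -/
theorem mem_sq_of_stalkDifferential_eq_zero_at (hφ : IsAnalytification (Fin B.dim → ℂ) B.X B.dim φ)
    (P : M) {x : B.X.left} (hx : (φ P).pt = x)
    (D : B.X.left.presheaf.stalk x →+ ((Fin B.dim → ℂ) →L[ℂ] ℂ))
    (hD : ∀ (U : B.X.left.Opens) (hU : x ∈ U) (s : Γ(B.X.left, U)),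
      D (B.X.left.presheaf.germ U x hU s) =
        fderiv ℂ (fun z ↦ evalOrZero U s (φ ((chartAt (Fin B.dim → ℂ) P).symm z)))
          (chartAt (Fin B.dim → ℂ) P P))
    {t : B.X.left.presheaf.stalk x} (ht : t ∈ IsLocalRing.maximalIdeal _) (hDt : D t = 0) :
    t ∈ IsLocalRing.maximalIdeal (B.X.left.presheaf.stalk x) ^ 2 := by
  letI := ((B.X.left.presheaf.germ ⊤ x trivial).hom.comp (B.X.hom.appTop.hom.comp (Scheme.ΓSpecIso (.of ℂ)).inv.hom)).toAlgebra
  obtain ⟨Ψ, hΨ⟩ := exists_cotangentDifferential_at hφ P hx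
  obtain ⟨U, hU, s, rfl⟩ := B.X.left.presheaf.exists_germ_eq t
  have h0 : Ψ ((IsLocalRing.maximalIdeal _).toCotangent ⟨_, ht⟩) = 0 := by
    rw [hΨ U hU s ht, ← hD U hU s, hDt]
  exact (Ideal.toCotangent_eq_zero _ _).1 (Ψ.injective (by rw [h0, map_zero]))

/-- Linear functionals on `E^* = (ℂⁿ →L ℂ)` are evaluations: `μ ℓ = ℓ v` with `vᵢ = μ(prᵢ)`. [folklore] -/
private theorem exists_eval_eq_of_functional (n : ℕ) (μ : ((Fin n → ℂ) →L[ℂ] ℂ) →ₗ[ℂ] ℂ) :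
    ∃ v : Fin n → ℂ, ∀ ℓ : (Fin n → ℂ) →L[ℂ] ℂ, μ ℓ = ℓ v := by
  classical
  refine ⟨fun i => μ (ContinuousLinearMap.proj i), fun ℓ => ?_⟩
  -- `ℓ = ∑ᵢ ℓ(eᵢ) • prᵢ`
  have hℓ : ℓ = ∑ i, ℓ (fun j => if i = j then (1 : ℂ) else 0) •
      (ContinuousLinearMap.proj (R := ℂ) (φ := fun _ : Fin n => ℂ) i) := by
    apply ContinuousLinearMap.ext
    intro x
    have h1 := ℓ.toLinearMap.pi_apply_eq_sum_univ x
    rw [ContinuousLinearMap.coe_coe] at h1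
    rw [h1, sum_apply]
    refine Finset.sum_congr rfl fun i _ => ?_
    rw [smul_apply, ContinuousLinearMap.proj_apply, smul_eq_mul, smul_eq_mul, mul_comm]
  have h2 := ℓ.toLinearMap.pi_apply_eq_sum_univ (fun i => μ (ContinuousLinearMap.proj i))
  rw [ContinuousLinearMap.coe_coe] at h2
  rw [h2]
  conv_lhs => rw [hℓ]
  rw [_root_.map_sum]
  refine Finset.sum_congr rfl fun i _ => ?_
  rw [LinearMap.map_smul_of_tower, smul_eq_mul, smul_eq_mul, mul_comm]

/-- **TANGENT IDENTIFICATION at a base point of the analytification (b3, general point).**  Let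
`φ : M → B(ℂ)` be an analytification of the complex abelian variety `B` (model `ℂ^{dim B}`), `P ∈ M`,
and `w` a `ℂ[ε]`-point of `B` through `x₀ = (φ P).pt`.  Then there is a UNIQUE `v ∈ ℂ^{dim B}` such that
for every regular `s` near `x₀` the `ε`-part of `s(w) ∈ ℂ[ε]` is the derivative of `s ∘ φ ∘ χ_P⁻¹` at
`χ_P P` along `v` (`χ_P = chartAt P`; for the torus `χ_P⁻¹ = π ∘ Φ⁻¹` globally): «`ℂ[ε]`-points through
`x₀` = `T_{x₀} B = V`».  Existence: the `ε`-part is a `ℂ`-linear derivation killing `𝔪²` (§1), the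
analytic stalk differential is onto `E^*` on `𝔪` (★ `exists_rational_cotangentFrame`) with kernel `𝔪²`
(`mem_sq_of_stalkDifferential_eq_zero_at`), so the `ε`-part factors through a functional on `E^*` = a
vector; uniqueness: the differentials of regular functions span `E^*`.
[cite: MumfordAV1970, §13 (proof of the Thm. pp. 125–130) and §1 (1)–(2)] [cite: GortzWedhorn2020, (6.3)–(6.4)]
[cite: LangeBirkenhake1992, §1.1.5 (before Lemma 1.1.22)] -/
theorem existsUnique_tangentVector_of_dualNumber_at
    (hφ : IsAnalytification (Fin B.dim → ℂ) B.X B.dim φ) (P : M)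
    (w : dualNumberOver ⟶ B.X) (hw : dualNumberBasePt w = (φ P).pt) :
    ∃! v : Fin B.dim → ℂ, ∀ (U : B.X.left.Opens) (hU : dualNumberBasePt w ∈ U) (s : Γ(B.X.left, U)),
      (dualNumberStalkHom w (B.X.left.presheaf.germ U _ hU s)).snd =
        fderiv ℂ (fun z ↦ evalOrZero U s (φ ((chartAt (Fin B.dim → ℂ) P).symm z)))
          (chartAt (Fin B.dim → ℂ) P P) v := by
  classical
  haveI : IsLocalRing (CommRingCat.of ℂ[ε]) := isLocalRing_of_dualNumber
  haveI : SmoothOfRelativeDimension B.dim B.X.hom := B.smoothOfRelativeDimension_dim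
  set x := dualNumberBasePt w with hxdef
  set E := Fin B.dim → ℂ with hE
  have hP : (φ P).pt = x := hw.symm
  -- the analytic stalk differential at `x`
  obtain ⟨D, hD⟩ := exists_stalkDifferential_of_eq hφ P hP
  -- the algebraic derivation `Dw t = (φ_w t).snd`
  let Dw : B.X.left.presheaf.stalk x → ℂ := fun t => (dualNumberStalkHom w t).snd
  have Dw_sub : ∀ a b, Dw (a - b) = Dw a - Dw b := fun a b => by
    change (dualNumberStalkHom w (a - b)).snd = _
    rw [map_sub, TrivSqZeroExt.snd_sub]
  -- GAGA at a point: a basis `ℓ` of `E^*` realised by differentials of regular functions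
  obtain ⟨ℓ, hli, hspan, hℓ, -⟩ := exists_rational_cotangentFrame (k := ℂ) hφ (P := P)
    (fun U hU s ↦ ⟨(φ P).eval U hU s, by rw [Algebra.algebraMap_self, RingHom.id_apply]⟩)
  -- sections `s i ∈ 𝔪_x` with `D (germ (s i)) = ℓ i`
  have hsec : ∀ i, ∃ (U : B.X.left.Opens) (hU : x ∈ U) (s : Γ(B.X.left, U)),
      B.X.left.presheaf.germ U x hU s ∈ IsLocalRing.maximalIdeal _ ∧
        D (B.X.left.presheaf.germ U x hU s) = ℓ i := by
    intro i
    obtain ⟨U, s, hPU, hDs⟩ := hℓ i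
    have hU : x ∈ U := hP ▸ hPU
    obtain ⟨hmem, hval⟩ := stalkDifferential_sub_value hφ P hP D hD U hU s
    exact ⟨U, hU, _, hmem, by rw [hval, hDs.fderiv]⟩
  choose U hU s hsm hDs using hsec
  -- the functional `μ` on `E^*` with `μ (ℓ i) = Dw (germ (s i))`
  let bℓ : Module.Basis (Fin B.dim) ℂ (E →L[ℂ] ℂ) := Module.Basis.mk hli hspan
  have hbℓ : ∀ i, bℓ i = ℓ i := fun i => Module.Basis.mk_apply hli hspan i
  let μ : (E →L[ℂ] ℂ) →ₗ[ℂ] ℂ := bℓ.constr ℂ fun i => Dw (B.X.left.presheaf.germ (U i) x (hU i) (s i))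
  have hμ : ∀ i, μ (ℓ i) = Dw (B.X.left.presheaf.germ (U i) x (hU i) (s i)) := fun i => by
    rw [← hbℓ]; exact bℓ.constr_basis ℂ _ i
  -- `Dw = μ ∘ D` on `𝔪_x`
  have hfac : ∀ t ∈ IsLocalRing.maximalIdeal (B.X.left.presheaf.stalk x), Dw t = μ (D t) := by
    intro t ht
    let c : Fin B.dim → ℂ := bℓ.repr (D t)
    have hDt : D t = ∑ i, c i • ℓ i := by
      conv_lhs => rw [← bℓ.sum_repr (D t)]
      simp only [hbℓ]
      rfl
    -- the combination `t' = ∑ cᵢ · germ (s i)` with scalar germs `cᵢ`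
    let κ : ℂ → B.X.left.presheaf.stalk x := fun a =>
      B.X.left.presheaf.germ ⊤ x trivial (B.X.hom.appTop ((Scheme.ΓSpecIso (.of ℂ)).inv a))
    let t' : B.X.left.presheaf.stalk x := ∑ i, κ (c i) * B.X.left.presheaf.germ (U i) x (hU i) (s i)
    have ht' : t' ∈ IsLocalRing.maximalIdeal _ :=
      Ideal.sum_mem _ fun i _ => Ideal.mul_mem_left _ _ (hsm i)
    have hDκ : ∀ (a : ℂ) (r : B.X.left.presheaf.stalk x), D (κ a * r) = a • D r := fun a r =>
      stalkDifferential_const_mul hφ P hP D hD a r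
    have hDt' : D t' = ∑ i, c i • ℓ i := by
      change D (∑ i, _) = _
      rw [map_sum]
      exact Finset.sum_congr rfl fun i _ => by rw [hDκ, hDs]
    -- `D (t - t') = 0`, so `t - t' ∈ 𝔪²` and `Dw (t - t') = 0`
    have hdiff : t - t' ∈ IsLocalRing.maximalIdeal (B.X.left.presheaf.stalk x) ^ 2 :=
      mem_sq_of_stalkDifferential_eq_zero_at hφ P hP D hD (sub_mem ht ht')
        (by rw [map_sub, hDt, hDt', sub_self])
    have hDw0 : Dw (t - t') = 0 := snd_dualNumberStalkHom_eq_zero_of_mem_sq w hdiff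
    have hDwt' : Dw t' = ∑ i, c i * Dw (B.X.left.presheaf.germ (U i) x (hU i) (s i)) := by
      change (dualNumberStalkHom w (∑ i, _)).snd = _
      rw [map_sum, TrivSqZeroExt.snd_sum]
      exact Finset.sum_congr rfl fun i _ => snd_dualNumberStalkHom_scalar_mul w (c i) _
    rw [Dw_sub, sub_eq_zero] at hDw0
    rw [hDw0, hDwt', hDt, map_sum]
    exact Finset.sum_congr rfl fun i _ => by rw [_root_.map_smul, hμ, smul_eq_mul]
  -- the vector `v` with `μ ℓ' = ℓ' v`
  obtain ⟨v, hv⟩ := exists_eval_eq_of_functional B.dim μ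
  refine ⟨v, fun V hV σ => ?_, fun v' hv' => ?_⟩
  · -- subtract the value: `germ σ₀ ∈ 𝔪_x`, same `ε`-part, same differential
    obtain ⟨hmem, hval⟩ := stalkDifferential_sub_value hφ P hP D hD V hV σ
    have hDwσ : Dw (B.X.left.presheaf.germ V x hV σ) =
        Dw (B.X.left.presheaf.germ V x hV (σ - B.X.left.presheaf.map (homOfLE (le_top : V ≤ ⊤)).op
          (B.X.hom.appTop ((Scheme.ΓSpecIso (.of ℂ)).inv (evalOrZero V σ (φ P)))))) := by
      rw [map_sub, Dw_sub, TopCat.Presheaf.germ_res_apply, show Dw _ = (0 : ℂ) from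
        snd_dualNumberStalkHom_germ_scalar w _, sub_zero]
    change Dw _ = _
    rw [hDwσ, hfac _ hmem, hv, hval]
  · -- uniqueness: the `ℓ i` separate points and `ℓ i v' = Dw (germ (s i)) = ℓ i v`
    have hi : ∀ i, ℓ i v' = ℓ i v := fun i => by
      have h1 := hv' (U i) (hU i) (s i)
      rw [← hD (U i) (hU i) (s i), hDs i] at h1
      rw [← h1]
      change Dw _ = _
      rw [hfac _ (hsm i), hDs i, hv]
    have hall : ∀ ℓ' : E →L[ℂ] ℂ, ℓ' v' = ℓ' v := by
      intro ℓ'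
      have hmem : ℓ' ∈ Submodule.span ℂ (Set.range ℓ) := hspan Submodule.mem_top
      refine Submodule.span_induction (fun _ ⟨i, hi'⟩ => hi' ▸ hi i) (by simp)
        (fun a b _ _ ha hb => by simp [ha, hb]) (fun c a _ ha => by simp [ha]) hmem
    funext j
    exact hall (ContinuousLinearMap.proj j)

omit [IsManifold 𝓘(ℂ, Fin B.dim → ℂ) ω M] in
/-- **b3 backwards at a general base point**: if the tangent vector of `w` (through `(φ P).pt`) vanishes,
`w` is constant. [cite: MumfordAV1970, §13 (proof of the Thm. pp. 125–130)] -/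
theorem exists_eq_toUnit_comp_of_tangentVector_eq_zero_at (P : M) (w : dualNumberOver ⟶ B.X)
    (h0 : ∀ (U : B.X.left.Opens) (hU : dualNumberBasePt w ∈ U) (s : Γ(B.X.left, U)),
      (dualNumberStalkHom w (B.X.left.presheaf.germ U _ hU s)).snd =
        fderiv ℂ (fun z ↦ evalOrZero U s (φ ((chartAt (Fin B.dim → ℂ) P).symm z)))
          (chartAt (Fin B.dim → ℂ) P P) 0) :
    ∃ x : 𝟙_ (SchemeOver ℂ) ⟶ B.X, w = CartesianMonoidalCategory.toUnit _ ≫ x := by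
  haveI : IsLocalRing (CommRingCat.of ℂ[ε]) := isLocalRing_of_dualNumber
  refine exists_eq_toUnit_comp_of_snd_eq_zero w fun t => ?_
  obtain ⟨U, hU, s, rfl⟩ := B.X.left.presheaf.exists_germ_eq t
  rw [h0 U hU s, map_zero]

end AnyPoint

end Literature.AlgebraicGeometry.Motives.AbelianVariety

end
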